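import Summits.BirchSwinnertonDyer.BirchSwinnertonDyer.Theorems.KolyvaginRoadThreeMethod2OddSelmerRankOfLevelInputs
import Summits.BirchSwinnertonDyer.BirchSwinnertonDyer.Theorems.KolyvaginRoadThreeMethod2StubA
import Summits.BirchSwinnertonDyer.BirchSwinnertonDyer.Theorems.KolyvaginRoadThreeMethod2LevelSystems
import Summits.BirchSwinnertonDyer.BirchSwinnertonDyer.Theorems.KolyvaginRoadThreeZhangSupplyEngineOfPoitouTate
import Summits.BirchSwinnertonDyer.BirchSwinnertonDyer.Theorems.KolyvaginRoadThreeMethod2KolyvaginIsoBound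
import Literature.NumberTheory.EllipticCurves.HeegnerPointsKolyvaginEulerSystem
import Summits.BirchSwinnertonDyer.BirchSwinnertonDyer.Theses.KolyvaginRoadThree
import HarnessLib

/-!
# Route `KolyvaginRoadThree`, deciding crux `ZhangSharpFrameAtThreeHL` (item stmt-BirchSwinnertonDyer-19574):
# KERNEL CERTIFICATE of the METHOD line's TERMINAL SHAPE under P-orientation (o2) —
# crux ⟸ {two EXISTING binders of the route's `closes`} + S1 + S2-KS + S2-ENGINE
# (cell `bsd-stepL`, OWNER seat `bsd-stepL-koly` g16; `--supports stmt-BirchSwinnertonDyer-19574 --as helper`)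

The registered skeleton v3 (`Cruxes/ZhangSharpFrameAtThreeHL/Lines/method2.lean`, sha 90adda8c) proves the crux BY NAME from SIX
stub texts: A (LANDED, koly g13 p489918), P (3-parity), S1 (bottom base case), S2-KS (W. Zhang's level Kolyvagin systems at
3), S2-ENGINE (the instantiated induction engine — provable, in flight) and two rungs (LANDED). The owner card (koly g15, CARD v3)
observed that P is INTRINSICALLY print-conditional, so the crux AS TYPED (no published-input binders) is not closable by this line,
and offered the planner option (o2): prefix the crux with binders the route's `closes` already owns. The companion file
`KolyvaginRoadThreeMethod2OddSelmerRankOfLevelInputs.lean` (koly g16 p522478) proved P from `gross_zagier`, `kolyvagin`,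
`hasEntireLFunction_rat` (conjuncts 1, 2, 7 of `PublishedInputsKolyThree` = binder `h₁` of `closes`) and
`∀ K, casselsTate_levelInputs K` (= the decl `ShimuraCasselsTateLevelInputs` of item 20191 = binder `hCT3` of `closes`).

THIS FILE is the kernel certificate of what (o2) buys, in two phrasings:
* `zhangSharpFrameAtThreeHL_of_levelInputs_of_bottom_of_levelSystems` — the crux decl BY NAME from the four Literature-level
  inputs (hGZ, hKo, hmod, hCT) + the TEXTS of S1, S2-KS, S2-ENGINE verbatim (A fed by its landed theorem, P by p522478):
  `crux ⟸ {GZ, Kolyvagin, modularity, levelwise Cassels–Tate} ∪ {S1, S2-KS, S2-ENGINE}`;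
* `zhangSharpFrameAtThreeHL_of_routeBinders_of_bottom_of_levelSystems` — the same with the two ROUTE SUPPORT DECLS
  `PublishedInputsKolyThree` and `ShimuraCasselsTateLevelInputs` as the leading binders (destructured), i.e. literally
  «crux ⟸ h₁ → hCT3 → S1 → S2-KS → S2-ENGINE». When S2-ENGINE lands by name (zhang3-p1 ∕ koly3b), its binder is fed and the
  residual of the METHOD line under (o2) is EXACTLY {S1, S2-KS} — the honest open mathematics at `p = 3 ∥ N` (W. Zhang's Thm 7.2 at
  the bottom and his level Kolyvagin systems, CARD §R bricks R2∕R6∕R7).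
The composition is the skeleton's `_of` (parity case split on `dim_𝔽₃ Sel₃(E/K)`): 0 defs, 0 named facts, 0 `sorry`; CONDITIONAL on
its displayed hypotheses; closes nothing (T7). PARTITION: O2@3 (B10) × A1 × crux 19574 — proves-glue (terminal-shape certificate).

References: [cite: WZhang2014, §9 proof of Thm. 9.1, Thm. 9.2] [cite: MilneADT2006, Ch. I §6, Thm. 6.13(a)]
[cite: GrossLMS1991, Prop. 2.3] [cite: KolyvaginEulerSystems1990, Thm. A].
-/

noncomputable section

open scoped Classical

namespace Summit.BirchSwinnertonDyer.Rank1Residual.X11b.Three.Koly.Method2CruxOfBinders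

open WeierstrassCurve NumberField IsDedekindDomain
  Literature.NumberTheory.EllipticCurves Literature.NumberTheory.EllipticCurves.ModularForms
  Literature.NumberTheory.GaloisRepresentations Module

open Summit.BirchSwinnertonDyer.Rank1Residual.X11b.Three.Koly.Method2

/-- **The crux `ZhangSharpFrameAtThreeHL` BY NAME from {Gross–Zagier, Kolyvagin, modularity, levelwise Cassels–Tate} and the
texts of S1, S2-KS, S2-ENGINE** (stub A fed by the landed `Method2StubA.stub_levelRaisingAtThree`, stub P by
`stub_oddSelmerRankAtThree_of_casselsTateLevelInputs`). Proof = the registered composition `_of`: complex conjugation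
`c ≠ 1`, the `ZMod 3`-structure of `H¹(K, E[3])`, P ⟹ odd Selmer rank; `dim = 1` ⟹ S1 (witness `n = 1`); `dim ≥ 3` ⟹ S2-ENGINE
fed with S2-KS's system, A's (A1) and the parity. CONDITIONAL; nothing booked. [cite: WZhang2014, §9 proof of Thm. 9.1, Thm. 9.2] -/
theorem zhangSharpFrameAtThreeHL_of_levelInputs_of_bottom_of_levelSystems
    (hGZ : ∀ (N : ℕ) [NeZero N] (W : WeierstrassCurve ℚ) (K : Type) [Field K] [NumberField K], gross_zagier N W K)
    (hKo : ∀ (N : ℕ) [NeZero N] (W : WeierstrassCurve ℚ) (K : Type) [Field K] [NumberField K], kolyvagin N W K)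
    (hmod : hasEntireLFunction_rat)
    (hCT : ∀ (K : Type) [Field K] [NumberField K], casselsTate_levelInputs K)
    (hS1 :
      ∀ (W : WeierstrassCurve ℚ) [W.IsElliptic] [W.IsGloballyMinimal] [NeZero (W.conductorNorm ℤ)] (K : Type)
        [Field K] [NumberField K] (Dt : ModularParametrizationData W (W.conductorNorm ℤ)) (β : ℤ) (ι : K →+* ℂ),
        Summit.BirchSwinnertonDyer.Rank1Residual.ClassX11b W 3 → W.HasMultiplicativeReductionAtPrime 3 →
        Rank1Residual.Surj W 3 → Rank1Residual.Ram W 3 → ¬ 3 ∣ W.tamagawaProduct → IsImaginaryQuadratic K →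
        Odd (NumberField.discr K) → SatisfiesHeegnerHypothesis (W.conductorNorm ℤ) K →
        (W.quadraticTwist (NumberField.discr K : ℚ)).entireLFunction 1 ≠ 0 → NumberField.discr K ≠ -3 →
        (4 * (W.conductorNorm ℤ : ℤ)) ∣ β ^ 2 - NumberField.discr K → ¬ (3 : ℤ) ∣ Dt.c →
        ∀ [Module (ZMod 3) (V3 W K)],
        finrank (ZMod 3)
          (AddSubgroup.toZModSubmodule 3 (selmerGroup (W.baseChange K) ((3 ^ 1 : ℕ) : ℤ))) = 1 →
        ∃ d : KolyvaginHeegnerData Dt β ι 1, d.kolyvaginClass Nat.prime_three 1 ≠ 0)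
    (hKS :
      ∀ (W : WeierstrassCurve ℚ) [W.IsElliptic] [W.IsGloballyMinimal] [NeZero (W.conductorNorm ℤ)] (K : Type)
        [Field K] [NumberField K] (Dt : ModularParametrizationData W (W.conductorNorm ℤ)) (β : ℤ) (ι : K →+* ℂ),
        Summit.BirchSwinnertonDyer.Rank1Residual.ClassX11b W 3 → W.HasMultiplicativeReductionAtPrime 3 →
        Rank1Residual.Surj W 3 → Rank1Residual.Ram W 3 → ¬ 3 ∣ W.tamagawaProduct → IsImaginaryQuadratic K →
        Odd (NumberField.discr K) → SatisfiesHeegnerHypothesis (W.conductorNorm ℤ) K →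
        (W.quadraticTwist (NumberField.discr K : ℚ)).entireLFunction 1 ≠ 0 → NumberField.discr K ≠ -3 →
        (4 * (W.conductorNorm ℤ : ℤ)) ∣ β ^ 2 - NumberField.discr K → ¬ (3 : ℤ) ∣ Dt.c →
        ∀ (c : K ≃ₐ[ℚ] K), c ≠ 1 → ∀ [Module (ZMod 3) (V3 W K)],
        Nonempty (LevelKolyvaginSystem W K Dt β ι c))
    (hEng :
      ∀ (W : WeierstrassCurve ℚ) [W.IsElliptic] [W.IsGloballyMinimal] [NeZero (W.conductorNorm ℤ)] (K : Type)
        [Field K] [NumberField K] (Dt : ModularParametrizationData W (W.conductorNorm ℤ)) (β : ℤ) (ι : K →+* ℂ),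
        Summit.BirchSwinnertonDyer.Rank1Residual.ClassX11b W 3 → W.HasMultiplicativeReductionAtPrime 3 →
        Rank1Residual.Surj W 3 → Rank1Residual.Ram W 3 → ¬ 3 ∣ W.tamagawaProduct → IsImaginaryQuadratic K →
        Odd (NumberField.discr K) → SatisfiesHeegnerHypothesis (W.conductorNorm ℤ) K →
        (W.quadraticTwist (NumberField.discr K : ℚ)).entireLFunction 1 ≠ 0 → NumberField.discr K ≠ -3 →
        (4 * (W.conductorNorm ℤ : ℤ)) ∣ β ^ 2 - NumberField.discr K → ¬ (3 : ℤ) ∣ Dt.c →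
        ∀ (c : K ≃ₐ[ℚ] K), c ≠ 1 → ∀ [Module (ZMod 3) (V3 W K)],
        LevelKolyvaginSystem W K Dt β ι c →
        (∀ (n : Finset {q // IsUAdmissiblePrime W K q}) (μ : Bool) (x : V3 W K),
          GoodLevel W K n → x ∈ SelQ W K c n μ → x ≠ 0 →
          ∃ q : {q // IsUAdmissiblePrime W K q}, q ∉ n ∧ GoodLevel W K (insert q n) ∧
            x ∉ SelQ W K c (insert q n) μ ∧
            SelQ W K c (insert q n) μ ≤ SelQ W K c n μ ∧
            finrank (ZMod 3) (SelQ W K c (insert q n) μ) + 1 = finrank (ZMod 3) (SelQ W K c n μ) ∧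
            SelQ W K c (insert q n) (!μ) = SelQ W K c n (!μ)) →
        Odd (finrank (ZMod 3)
          (AddSubgroup.toZModSubmodule 3 (selmerGroup (W.baseChange K) ((3 ^ 1 : ℕ) : ℤ)))) →
        3 ≤ finrank (ZMod 3)
          (AddSubgroup.toZModSubmodule 3 (selmerGroup (W.baseChange K) ((3 ^ 1 : ℕ) : ℤ))) →
        ∃ (n : ℕ) (d : KolyvaginHeegnerData Dt β ι n),
          KolyvaginDescent.KolSupp (Zhang2014.IsKolyvaginPrime (W.conductorNorm ℤ) W K 3) n ∧
            d.kolyvaginClass Nat.prime_three 1 ≠ 0)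
 :
    Summit.BirchSwinnertonDyer.BirchSwinnertonDyer.Theses.KolyvaginRoadThree.ZhangSharpFrameAtThreeHL := by
  intro W _ _ _ K _ _ Dt β ι hX hmult hsurj hram htam hK hodd hH hLt h3 hβ hc
  obtain ⟨c, hc1, -⟩ := Literature.NumberTheory.EllipticCurves.exists_conj_of_isImaginaryQuadratic (K := K) hK
  -- the unique `ZMod 3`-module structure on `H¹(K, E[3])`
  letI : Module (ZMod 3) (V3 W K) :=
    AddCommGroup.zmodModule (fun x ↦ by
      have h := zsmul_discreteH1_torsion ((3 ^ 1 : ℕ) : ℤ) x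
      rw [natCast_zsmul] at h
      simpa using h)
  have hPar := stub_oddSelmerRankAtThree_of_casselsTateLevelInputs hGZ hKo hmod hCT W K Dt β ι hX hmult hsurj hram htam
    hK hodd hH hLt h3 hβ hc
  by_cases h1 : finrank (ZMod 3)
        (AddSubgroup.toZModSubmodule 3 (selmerGroup (W.baseChange K) ((3 ^ 1 : ℕ) : ℤ))) = 1
  · -- Selmer rank one: the bottom base case, witness `n = 1`
    obtain ⟨d, hd⟩ := hS1 W K Dt β ι hX hmult hsurj hram htam hK hodd hH hLt h3 hβ hc h1
    exact ⟨1, d, KolyvaginDescent.kolSupp_one _, hd⟩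
  · -- Selmer rank odd and `≠ 1`, hence `≥ 3`: Zhang's induction above the bottom, fed with (A1) and a level system
    have hA1 := Method2StubA.stub_levelRaisingAtThree W K Dt β ι hX hmult hsurj hram htam hK hodd hH hLt h3 hβ hc c hc1
    have h3le : 3 ≤ finrank (ZMod 3)
        (AddSubgroup.toZModSubmodule 3 (selmerGroup (W.baseChange K) ((3 ^ 1 : ℕ) : ℤ))) := by
      obtain ⟨k, hk⟩ := hPar
      omega
    obtain ⟨S⟩ := hKS W K Dt β ι hX hmult hsurj hram htam hK hodd hH hLt h3 hβ hc c hc1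
    exact hEng W K Dt β ι hX hmult hsurj hram htam hK hodd hH hLt h3 hβ hc c hc1 S hA1 hPar h3le

/-- **The same certificate with the ROUTE'S SUPPORT DECLS as leading binders**: `PublishedInputsKolyThree` (item 19156, binder
`h₁` of the route's `closes`; conjuncts 1, 2, 7 used) and `ShimuraCasselsTateLevelInputs` (item 20191, binder `hCT3`). Under the
planner's option (o2) (crux restated with these two prefixes) the METHOD line's residual is literally {S1, S2-KS, S2-ENGINE},
and {S1, S2-KS} once S2-ENGINE lands. CONDITIONAL; nothing booked. [cite: WZhang2014, §9 proof of Thm. 9.1, Thm. 9.2] -/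
theorem zhangSharpFrameAtThreeHL_of_routeBinders_of_bottom_of_levelSystems
    (h₁ : Summit.BirchSwinnertonDyer.BirchSwinnertonDyer.Theses.KolyvaginRoadThree.PublishedInputsKolyThree)
    (hCT3 : Summit.BirchSwinnertonDyer.BirchSwinnertonDyer.Theses.KolyvaginRoadThree.ShimuraCasselsTateLevelInputs)
    (hS1 :
      ∀ (W : WeierstrassCurve ℚ) [W.IsElliptic] [W.IsGloballyMinimal] [NeZero (W.conductorNorm ℤ)] (K : Type)
        [Field K] [NumberField K] (Dt : ModularParametrizationData W (W.conductorNorm ℤ)) (β : ℤ) (ι : K →+* ℂ),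
        Summit.BirchSwinnertonDyer.Rank1Residual.ClassX11b W 3 → W.HasMultiplicativeReductionAtPrime 3 →
        Rank1Residual.Surj W 3 → Rank1Residual.Ram W 3 → ¬ 3 ∣ W.tamagawaProduct → IsImaginaryQuadratic K →
        Odd (NumberField.discr K) → SatisfiesHeegnerHypothesis (W.conductorNorm ℤ) K →
        (W.quadraticTwist (NumberField.discr K : ℚ)).entireLFunction 1 ≠ 0 → NumberField.discr K ≠ -3 →
        (4 * (W.conductorNorm ℤ : ℤ)) ∣ β ^ 2 - NumberField.discr K → ¬ (3 : ℤ) ∣ Dt.c →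
        ∀ [Module (ZMod 3) (V3 W K)],
        finrank (ZMod 3)
          (AddSubgroup.toZModSubmodule 3 (selmerGroup (W.baseChange K) ((3 ^ 1 : ℕ) : ℤ))) = 1 →
        ∃ d : KolyvaginHeegnerData Dt β ι 1, d.kolyvaginClass Nat.prime_three 1 ≠ 0)
    (hKS :
      ∀ (W : WeierstrassCurve ℚ) [W.IsElliptic] [W.IsGloballyMinimal] [NeZero (W.conductorNorm ℤ)] (K : Type)
        [Field K] [NumberField K] (Dt : ModularParametrizationData W (W.conductorNorm ℤ)) (β : ℤ) (ι : K →+* ℂ),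
        Summit.BirchSwinnertonDyer.Rank1Residual.ClassX11b W 3 → W.HasMultiplicativeReductionAtPrime 3 →
        Rank1Residual.Surj W 3 → Rank1Residual.Ram W 3 → ¬ 3 ∣ W.tamagawaProduct → IsImaginaryQuadratic K →
        Odd (NumberField.discr K) → SatisfiesHeegnerHypothesis (W.conductorNorm ℤ) K →
        (W.quadraticTwist (NumberField.discr K : ℚ)).entireLFunction 1 ≠ 0 → NumberField.discr K ≠ -3 →
        (4 * (W.conductorNorm ℤ : ℤ)) ∣ β ^ 2 - NumberField.discr K → ¬ (3 : ℤ) ∣ Dt.c →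
        ∀ (c : K ≃ₐ[ℚ] K), c ≠ 1 → ∀ [Module (ZMod 3) (V3 W K)],
        Nonempty (LevelKolyvaginSystem W K Dt β ι c))
    (hEng :
      ∀ (W : WeierstrassCurve ℚ) [W.IsElliptic] [W.IsGloballyMinimal] [NeZero (W.conductorNorm ℤ)] (K : Type)
        [Field K] [NumberField K] (Dt : ModularParametrizationData W (W.conductorNorm ℤ)) (β : ℤ) (ι : K →+* ℂ),
        Summit.BirchSwinnertonDyer.Rank1Residual.ClassX11b W 3 → W.HasMultiplicativeReductionAtPrime 3 →
        Rank1Residual.Surj W 3 → Rank1Residual.Ram W 3 → ¬ 3 ∣ W.tamagawaProduct → IsImaginaryQuadratic K →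
        Odd (NumberField.discr K) → SatisfiesHeegnerHypothesis (W.conductorNorm ℤ) K →
        (W.quadraticTwist (NumberField.discr K : ℚ)).entireLFunction 1 ≠ 0 → NumberField.discr K ≠ -3 →
        (4 * (W.conductorNorm ℤ : ℤ)) ∣ β ^ 2 - NumberField.discr K → ¬ (3 : ℤ) ∣ Dt.c →
        ∀ (c : K ≃ₐ[ℚ] K), c ≠ 1 → ∀ [Module (ZMod 3) (V3 W K)],
        LevelKolyvaginSystem W K Dt β ι c →
        (∀ (n : Finset {q // IsUAdmissiblePrime W K q}) (μ : Bool) (x : V3 W K),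
          GoodLevel W K n → x ∈ SelQ W K c n μ → x ≠ 0 →
          ∃ q : {q // IsUAdmissiblePrime W K q}, q ∉ n ∧ GoodLevel W K (insert q n) ∧
            x ∉ SelQ W K c (insert q n) μ ∧
            SelQ W K c (insert q n) μ ≤ SelQ W K c n μ ∧
            finrank (ZMod 3) (SelQ W K c (insert q n) μ) + 1 = finrank (ZMod 3) (SelQ W K c n μ) ∧
            SelQ W K c (insert q n) (!μ) = SelQ W K c n (!μ)) →
        Odd (finrank (ZMod 3)
          (AddSubgroup.toZModSubmodule 3 (selmerGroup (W.baseChange K) ((3 ^ 1 : ℕ) : ℤ)))) →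
        3 ≤ finrank (ZMod 3)
          (AddSubgroup.toZModSubmodule 3 (selmerGroup (W.baseChange K) ((3 ^ 1 : ℕ) : ℤ))) →
        ∃ (n : ℕ) (d : KolyvaginHeegnerData Dt β ι n),
          KolyvaginDescent.KolSupp (Zhang2014.IsKolyvaginPrime (W.conductorNorm ℤ) W K 3) n ∧
            d.kolyvaginClass Nat.prime_three 1 ≠ 0)
 :
    Summit.BirchSwinnertonDyer.BirchSwinnertonDyer.Theses.KolyvaginRoadThree.ZhangSharpFrameAtThreeHL := by
  obtain ⟨⟨hGZ, hKo, -, -, -, -, hmod, -⟩, -⟩ := h₁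
  exact zhangSharpFrameAtThreeHL_of_levelInputs_of_bottom_of_levelSystems hGZ hKo hmod hCT3 hS1 hKS hEng

/-! ## §2 (APPEND, OWNER koly g17, 2026-08-27 — after the S2-ENGINE landings of koly3b g6 part XXVI p532734
`ZhangSupply.stub_inductionOfLevelSystemsAtThree_of_poitouTate_of_rigidity` and zhang3-p1 g10 p531202
`KolyLocal.sub_zsmul_mem_torsionLocalKer_of_isotropic`; plan g33 RULING 21 (B): P-orientation (o1) stands, the PUB input
`poitouTate_selmerStructure_duality` becomes the line's own by-name stub of skeleton v3.1, terminal certificate (1) GO)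

The S2-ENGINE stub `stub_inductionOfLevelSystemsAtThree` is now a kernel theorem MODULO ONE named PUB fact: Poitou–Tate
global duality for Selmer structures (`Literature.NumberTheory.GaloisCohomology.poitouTate_selmerStructure_duality`,
Howard 2004 Thm. 2.1.11 ∕ Milne *ADT* I Thm. 4.10(b) ∕ Rubin Thm. 1.7.3) at the frame's imaginary quadratic field — the input
of W. Zhang's Lemma 8.2 = McCallum's Prop. 2.1 ∕ Lemma 5.3 («It follows from Tate global duality ([6], Chapter I, Theorem
4.10) that … the image of H¹(K_T∕K, E_m) is a maximal isotropic subgroup», L-Functions and Arithmetic p. 296), on which the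
route's own PUB binder `McCallum1991_pow_dvd_card_sha_primary_of_certificate` already rests in print. The local line-rigidity
`hRig` of part XXVI is DISCHARGED by zhang3-p1's theorem, so:
* `stub_inductionOfLevelSystemsAtThree_of_poitouTate` — the REGISTERED S2-ENGINE text ⟸ `hPT` alone (one line: XXVI ∘ p531202);
* `zhangSharpFrameAtThreeHL_of_routeBinders_of_poitouTate_of_bottom_of_levelSystems` — THE TERMINAL CERTIFICATE OF THE
  METHOD LINE: the crux decl BY NAME ⟸ `h₁ = PublishedInputsKolyThree` (conjuncts 1, 2, 7) + `hCT3 =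
  ShimuraCasselsTateLevelInputs` (item 20191) + `hPT` + the texts of S1 and S2-KS. I.e. the line's residual is EXACTLY
  {one refereed global-duality theorem (being formalised by the cell bsd-schneider: class-formation axioms I∕II landed
  2026-08-27; or the tree's `poitouTate_selmerStructure_duality_of_middleExact_canonical` road), S1 (W. Zhang Thm 7.2 at the
  bottom, p = 3), S2-KS (his level Kolyvagin systems at p = 3)} — the last two are the honest open mathematics (CARD v3 §R).
0 defs, 0 named facts, 0 `sorry`; CONDITIONAL on the displayed hypotheses; nothing is booked; closes nothing (T7).
[cite: WZhang2014, §9 proof of Thm. 9.1, Lemma 8.2, Lemma 8.4] [cite: McCallumLMS1991, Prop. 2.1, Lemma 5.3]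
[cite: MilneADT2006, Ch. I, Thm. 4.10] [cite: Howard2004HeegnerKolyvagin, Thm. 2.1.11] -/

/-- **S2-ENGINE's registered text from the Poitou–Tate Selmer-structure fact ALONE.** koly3b g6's
`ZhangSupply.stub_inductionOfLevelSystemsAtThree_of_poitouTate_of_rigidity` with its local line-rigidity hypothesis `hRig`
fed by zhang3-p1 g10's `KolyLocal.sub_zsmul_mem_torsionLocalKer_of_isotropic` (Gross Prop. 8.1–8.2 ∕ 9.6: at a Kolyvagin
`λ` the `s`-eigenspace of `H¹(K_λ, E[3])` is Kummer line ⊕ singular line, perfectly paired, so mutually and self isotropic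
eigenclasses have proportional localisations). CONDITIONAL on `hPT`; nothing is booked.
[cite: WZhang2014, §9 proof of Thm. 9.1, Lemma 8.2, Lemma 8.4] [cite: GrossLMS1991, Prop. 8.1–8.2, 9.6]
[cite: MilneADT2006, Ch. I, Thm. 4.10] -/
theorem stub_inductionOfLevelSystemsAtThree_of_poitouTate
    (hPT : ∀ (K : Type) [Field K] [NumberField K], IsImaginaryQuadratic K →
      Literature.NumberTheory.GaloisCohomology.poitouTate_selmerStructure_duality K) :
    ∀ (W : WeierstrassCurve ℚ) [W.IsElliptic] [W.IsGloballyMinimal] [NeZero (W.conductorNorm ℤ)] (K : Type)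
      [Field K] [NumberField K] (Dt : ModularParametrizationData W (W.conductorNorm ℤ)) (β : ℤ) (ι : K →+* ℂ),
      Summit.BirchSwinnertonDyer.Rank1Residual.ClassX11b W 3 → W.HasMultiplicativeReductionAtPrime 3 →
      Rank1Residual.Surj W 3 → Rank1Residual.Ram W 3 → ¬ 3 ∣ W.tamagawaProduct → IsImaginaryQuadratic K →
      Odd (NumberField.discr K) → SatisfiesHeegnerHypothesis (W.conductorNorm ℤ) K →
      (W.quadraticTwist (NumberField.discr K : ℚ)).entireLFunction 1 ≠ 0 → NumberField.discr K ≠ -3 →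
      (4 * (W.conductorNorm ℤ : ℤ)) ∣ β ^ 2 - NumberField.discr K → ¬ (3 : ℤ) ∣ Dt.c →
      ∀ (c : K ≃ₐ[ℚ] K), c ≠ 1 → ∀ [Module (ZMod 3) (V3 W K)],
      LevelKolyvaginSystem W K Dt β ι c →
      (∀ (n : Finset {q // IsUAdmissiblePrime W K q}) (μ : Bool) (x : V3 W K),
        GoodLevel W K n → x ∈ SelQ W K c n μ → x ≠ 0 →
        ∃ q : {q // IsUAdmissiblePrime W K q}, q ∉ n ∧ GoodLevel W K (insert q n) ∧
          x ∉ SelQ W K c (insert q n) μ ∧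
          SelQ W K c (insert q n) μ ≤ SelQ W K c n μ ∧
          finrank (ZMod 3) (SelQ W K c (insert q n) μ) + 1 = finrank (ZMod 3) (SelQ W K c n μ) ∧
          SelQ W K c (insert q n) (!μ) = SelQ W K c n (!μ)) →
      Odd (finrank (ZMod 3)
        (AddSubgroup.toZModSubmodule 3 (selmerGroup (W.baseChange K) ((3 ^ 1 : ℕ) : ℤ)))) →
      3 ≤ finrank (ZMod 3)
        (AddSubgroup.toZModSubmodule 3 (selmerGroup (W.baseChange K) ((3 ^ 1 : ℕ) : ℤ))) →
      ∃ (n : ℕ) (d : KolyvaginHeegnerData Dt β ι n),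
        KolyvaginDescent.KolSupp (Zhang2014.IsKolyvaginPrime (W.conductorNorm ℤ) W K 3) n ∧
          d.kolyvaginClass Nat.prime_three 1 ≠ 0 :=
  ZhangSupply.stub_inductionOfLevelSystemsAtThree_of_poitouTate_of_rigidity hPT
    (fun W _ _ K _ _ hK hsurj _c hc e hμ hadd₁ hadd₂ halt hnondeg hgal _ℓ hℓ v hv s _x _y hxs hys h11 h12 h21 h22 hx0 ↦
      KolyLocal.sub_zsmul_mem_torsionLocalKer_of_isotropic W K hK hsurj hc e hμ hadd₁ hadd₂ halt hnondeg hgal hℓ v hv s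
        hxs hys h11 h12 h21 h22 hx0)

/-- **THE TERMINAL CERTIFICATE OF THE METHOD LINE (owner koly g17).** The crux `ZhangSharpFrameAtThreeHL` BY NAME from
the two route support decls `PublishedInputsKolyThree` (item 19156, binder `h₁` of `closes`; conjuncts 1, 2, 7 =
Gross–Zagier, Kolyvagin, modularity) and `ShimuraCasselsTateLevelInputs` (item 20191, binder `hCT3`), the named PUB fact
`poitouTate_selmerStructure_duality` at imaginary quadratic fields (`hPT`, skeleton v3.1's own stub), and the TEXTS of the
two open stubs S1 (`stub_bottomRankOneAtThree`) and S2-KS (`stub_levelKolyvaginSystemsAtThree`). Stub A is the landed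
theorem (koly g13 p489918), stub P is fed by p522478, S2-ENGINE by the previous theorem. So the METHOD line's residual is
EXACTLY {hPT (PUB), S1, S2-KS}. CONDITIONAL; nothing is booked; no class of O2@3 moves.
[cite: WZhang2014, §9 proof of Thm. 9.1, Thm. 9.2, Lemma 8.2] [cite: McCallumLMS1991, Prop. 2.1, §5 Cor. 5.6]
[cite: MilneADT2006, Ch. I, Thm. 4.10] -/
theorem zhangSharpFrameAtThreeHL_of_routeBinders_of_poitouTate_of_bottom_of_levelSystems
    (h₁ : Summit.BirchSwinnertonDyer.BirchSwinnertonDyer.Theses.KolyvaginRoadThree.PublishedInputsKolyThree)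
    (hCT3 : Summit.BirchSwinnertonDyer.BirchSwinnertonDyer.Theses.KolyvaginRoadThree.ShimuraCasselsTateLevelInputs)
    (hPT : ∀ (K : Type) [Field K] [NumberField K], IsImaginaryQuadratic K →
      Literature.NumberTheory.GaloisCohomology.poitouTate_selmerStructure_duality K)
    (hS1 :
      ∀ (W : WeierstrassCurve ℚ) [W.IsElliptic] [W.IsGloballyMinimal] [NeZero (W.conductorNorm ℤ)] (K : Type)
        [Field K] [NumberField K] (Dt : ModularParametrizationData W (W.conductorNorm ℤ)) (β : ℤ) (ι : K →+* ℂ),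
        Summit.BirchSwinnertonDyer.Rank1Residual.ClassX11b W 3 → W.HasMultiplicativeReductionAtPrime 3 →
        Rank1Residual.Surj W 3 → Rank1Residual.Ram W 3 → ¬ 3 ∣ W.tamagawaProduct → IsImaginaryQuadratic K →
        Odd (NumberField.discr K) → SatisfiesHeegnerHypothesis (W.conductorNorm ℤ) K →
        (W.quadraticTwist (NumberField.discr K : ℚ)).entireLFunction 1 ≠ 0 → NumberField.discr K ≠ -3 →
        (4 * (W.conductorNorm ℤ : ℤ)) ∣ β ^ 2 - NumberField.discr K → ¬ (3 : ℤ) ∣ Dt.c →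
        ∀ [Module (ZMod 3) (V3 W K)],
        finrank (ZMod 3)
          (AddSubgroup.toZModSubmodule 3 (selmerGroup (W.baseChange K) ((3 ^ 1 : ℕ) : ℤ))) = 1 →
        ∃ d : KolyvaginHeegnerData Dt β ι 1, d.kolyvaginClass Nat.prime_three 1 ≠ 0)
    (hKS :
      ∀ (W : WeierstrassCurve ℚ) [W.IsElliptic] [W.IsGloballyMinimal] [NeZero (W.conductorNorm ℤ)] (K : Type)
        [Field K] [NumberField K] (Dt : ModularParametrizationData W (W.conductorNorm ℤ)) (β : ℤ) (ι : K →+* ℂ),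
        Summit.BirchSwinnertonDyer.Rank1Residual.ClassX11b W 3 → W.HasMultiplicativeReductionAtPrime 3 →
        Rank1Residual.Surj W 3 → Rank1Residual.Ram W 3 → ¬ 3 ∣ W.tamagawaProduct → IsImaginaryQuadratic K →
        Odd (NumberField.discr K) → SatisfiesHeegnerHypothesis (W.conductorNorm ℤ) K →
        (W.quadraticTwist (NumberField.discr K : ℚ)).entireLFunction 1 ≠ 0 → NumberField.discr K ≠ -3 →
        (4 * (W.conductorNorm ℤ : ℤ)) ∣ β ^ 2 - NumberField.discr K → ¬ (3 : ℤ) ∣ Dt.c →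
        ∀ (c : K ≃ₐ[ℚ] K), c ≠ 1 → ∀ [Module (ZMod 3) (V3 W K)],
        Nonempty (LevelKolyvaginSystem W K Dt β ι c)) :
    Summit.BirchSwinnertonDyer.BirchSwinnertonDyer.Theses.KolyvaginRoadThree.ZhangSharpFrameAtThreeHL :=
  zhangSharpFrameAtThreeHL_of_routeBinders_of_bottom_of_levelSystems h₁ hCT3 hS1 hKS
    (stub_inductionOfLevelSystemsAtThree_of_poitouTate hPT)

end Summit.BirchSwinnertonDyer.Rank1Residual.X11b.Three.Koly.Method2CruxOfBinders

end
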